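import Mathlib.NumberTheory.Zsqrtd.Basic
import Mathlib.Data.ZMod.Basic
import Mathlib.Tactic.LinearCombination
import Mathlib.Tactic.Linarith
import HarnessLib

/-!
# `ℤ[√14]` is not Euclidean for the norm (Samuel 1971, §5 Remark (2))

Topic `Literature/NumberTheory/QuadraticFields`, namespace `Literature.NumberTheory.QuadraticFields.ZSqrtFourteen`.
THEOREMS ONLY (no `def`, no instance, no named fact), all proved, about Mathlib's `ℤ√14 = Zsqrtd 14` and its norm
`Zsqrtd.norm (a + b√14) = a² − 14b²`.

## Source (read at the page)

P. Samuel, *About Euclidean rings*, J. Algebra **19** (1971) 282–301 [Samuel1971] (materialised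
`paper:doi-10-1016-0021-8693-71-90110-4`), §5 Remark (2), p. 294, VERBATIM: «Concerning real quadratic fields, the ones
for which the ring of integers is Euclidean are not known.  Even one does not know whether there exists such a field for
which the ring of integers is Euclidean without being Euclidean for the norm (i.e. a field outside the above list of
sixteen).  A possible candidate might be the ring `A = ℤ[√14]`.  This is known to be principal.  Its fundamental unit
is `15 + 4√14`, whence its units have the form `a + b√14` with `b` even.  The elements of the coset `1 + √14 + 2A`
cannot thus be units, whence none of them can have a norm `< N(2) = 4` since `3` is not a norm in `A` (the ideal `3A`
is prime).  This shows that `A` is not Euclidean for the norm.»  (§5, p. 292: «Given an Euclidean domain `A` with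
finite residue fields, one can ask whether the norm is an algorithm on `A`», the norm of `b` being `n(b) = card(A/Ab)
= |N_{K/ℚ}(b)|` for an order of a number field, p. 291; «Euclidean for the norm» = the norm is an algorithm: for
`b ≠ 0` every `a` is `bq + r` with `n(r) < n(b)`, Definition 1, p. 282.)

## What is formalised

* §1 «its units have the form `a + b√14` with `b` even» (`ZSqrtFourteen.even_im_of_isUnit`; proved from the
  congruences `a² − 14b² = 1 ⟹ b` even (mod 4) and `a² − 14b² ≠ −1` (mod 7) rather than from the fundamental unit, which
  is only checked to BE a unit: `ZSqrtFourteen.isUnit_fundamentalUnit`, `N(15 + 4√14) = 1`);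
* §2 «`3` is not a norm in `A` (the ideal `3A` is prime)»: no element has norm `3` (mod 7) nor `−3` (mod 8)
  (`ZSqrtFourteen.norm_ne_three`, `ZSqrtFourteen.norm_ne_neg_three`); `3` is a prime element of `ℤ[√14]`
  (**`ZSqrtFourteen.prime_three`**, via `3 ∣ z ⟺ 3 ∣ N(z)`), whence Samuel's own inference `|N(z)| ≠ 3`
  (`ZSqrtFourteen.natAbs_norm_ne_three'`);
* §3 «The elements of the coset `1 + √14 + 2A` … none of them can have a norm `< N(2) = 4`»: an element with both
  coordinates odd has `|N| ≥ 5` (**`ZSqrtFourteen.five_le_natAbs_norm_of_odd`**: `N ≡ 3 (mod 8)` rules out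
  `0, ±1, ±2, ±4, −3`, and `3` is not a norm);
* §4 **«`A` is not Euclidean for the norm»** (**`ZSqrtFourteen.not_normEuclidean`**: dividing `1 + √14` by `2` every
  remainder lies in the coset), also in Motzkin's form with `r = 0` allowed (`ZSqrtFourteen.not_normEuclidean'`) and in
  Hardy–Wright's rational form (14.7.2) «given `δ ∈ k(√m)` there is an integer `κ` with `|N(δ − κ)| < 1`», refuted at
  `δ = (1 + √14)/2` (**`ZSqrtFourteen.not_criterion`**) — the case `m = 14 < 100` not covered by the tree's
  `RealEuclideanQuadraticFieldsFinite.not_criterion_of_le` (`m ≥ 100`) and `no_algorithm_sqrt_twentythree` (`m = 23`).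
-- TODO(general form): «This is known to be principal» (class number one of `ℚ(√14)`), that `15 + 4√14` is THE fundamental
-- unit, and Harper's 2004 theorem that `ℤ[√14]` IS Euclidean (for some transfinite/other function) are not formalised here.

## Mathlib / tree search

Mathlib: `Zsqrtd` (`norm_def`, `norm_mul`, `norm_eq_one_iff`, `re_mul`, `im_mul`, `Zsqrtd.ext`), `ZMod n` with `decide`,
`Int.emod_emod_of_dvd`; nothing on `ℤ√14`.  Tree: `RealEuclideanQuadraticFields.lean` / `RealEuclideanQuadraticFieldsFinite.lean`
(Hardy–Wright Thms 247–249: the criterion (14.7.2) `∀ r s : ℚ, ∃ x y : ℤ, |(r − x)² − m(s − y)²| < 1`, refuted for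
`m = 23` and for `m ≥ 100`, `m ≡ 2, 3 (mod 4)`; `m = 14` absent), `EuclideanQuadraticFieldFundamentalTheorem.lean` (the
spelled-out form (E) `γ = κγ₁ + γ₂ ∧ |Nγ₂| < |Nγ₁|`), `ZSqrtTenTransfiniteConstruction.lean` (the sister remark on
`ℤ[√10]`); `rg "√14|Zsqrtd 14"` in `Literature/NumberTheory` → nothing.
-/

namespace Literature.NumberTheory.QuadraticFields.ZSqrtFourteen

open Zsqrtd

/-! ## §1 Units of `ℤ[√14]` have an even coefficient of `√14` -/

/-- `N(15 + 4√14) = 225 − 224 = 1`. [cite: Samuel1971, §5 Remark (2) (p. 294)] -/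
theorem norm_fundamentalUnit : (⟨15, 4⟩ : ℤ√14).norm = 1 := by
  rw [norm_def]; norm_num

/-- «Its fundamental unit is `15 + 4√14`» — here only: `15 + 4√14` is a unit, with inverse `15 − 4√14`.
[cite: Samuel1971, §5 Remark (2) (p. 294)] -/
theorem isUnit_fundamentalUnit : IsUnit (⟨15, 4⟩ : ℤ√14) :=
  IsUnit.of_mul_eq_one (⟨15, -4⟩ : ℤ√14) (by decide)

/-- No element of `ℤ[√14]` has norm `−1`: `a² − 14b² = −1` is impossible mod `7` (`−1` is not a square mod `7`).
[cite: Samuel1971, §5 Remark (2) (p. 294)] -/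
theorem norm_ne_neg_one (z : ℤ√14) : z.norm ≠ -1 := by
  rw [norm_def]
  intro h
  have key : ∀ a : ZMod 7, a * a ≠ -1 := by decide
  apply key (z.re : ZMod 7)
  have := congrArg (fun t : ℤ ↦ (t : ZMod 7)) h
  push_cast at this
  have h14 : (z.im : ZMod 7) * (z.im : ZMod 7) * 14 = 0 := by
    rw [show (14 : ZMod 7) = 0 by decide, mul_zero]
  linear_combination this + h14

/-- A unit of `ℤ[√14]` has norm `+1`. [cite: Samuel1971, §5 Remark (2) (p. 294)] -/
theorem norm_eq_one_of_isUnit {z : ℤ√14} (hz : IsUnit z) : z.norm = 1 := by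
  have h := (norm_eq_one_iff (x := z)).2 hz
  rcases Int.natAbs_eq z.norm with h' | h' <;> rw [h] at h'
  · exact_mod_cast h'
  · exact absurd (by exact_mod_cast h' : z.norm = -1) (norm_ne_neg_one z)

/-- **«its units have the form `a + b√14` with `b` even»**: `a² − 14b² = 1` with `b` odd would give `a² ≡ 3 (mod 4)`.
[cite: Samuel1971, §5 Remark (2) (p. 294)] -/
theorem even_im_of_isUnit {z : ℤ√14} (hz : IsUnit z) : Even z.im := by
  have h := norm_eq_one_of_isUnit hz
  rw [norm_def] at h
  -- mod 4: squares are 0 or 1 and `14 b² ≡ 2 b²`, so `b ≡ 0, 2 (mod 4)`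
  have key : ∀ a b : ZMod 4, a * a - 14 * b * b = 1 → b = 0 ∨ b = 2 := by decide
  have h4 := congrArg (fun t : ℤ ↦ (t : ZMod 4)) h
  push_cast at h4
  rcases key _ _ h4 with h0 | h2
  · obtain ⟨c, hc⟩ := (ZMod.intCast_zmod_eq_zero_iff_dvd z.im 4).1 h0
    exact ⟨2 * c, by rw [hc]; ring⟩
  · have h2' : ((z.im - 2 : ℤ) : ZMod 4) = 0 := by push_cast; rw [h2]; ring
    obtain ⟨c, hc⟩ := (ZMod.intCast_zmod_eq_zero_iff_dvd (z.im - 2) 4).1 h2'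
    exact ⟨2 * c + 1, by linear_combination hc⟩

/-- Hence no element `a + b√14` with `b` odd is a unit («The elements of the coset `1 + √14 + 2A` cannot thus be
units»). [cite: Samuel1971, §5 Remark (2) (p. 294)] -/
theorem not_isUnit_of_odd_im {z : ℤ√14} (hz : Odd z.im) : ¬IsUnit z := fun hu ↦
  (Int.not_even_iff_odd.2 hz) (even_im_of_isUnit hu)

/-! ## §2 `±3` is not a norm («`3` is not a norm in `A` (the ideal `3A` is prime)») -/

/-- No element of `ℤ[√14]` has norm `3`: `a² ≡ 3 (mod 7)` is impossible. [cite: Samuel1971, §5 Remark (2) (p. 294)] -/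
theorem norm_ne_three (z : ℤ√14) : z.norm ≠ 3 := by
  rw [norm_def]
  intro h
  have key : ∀ a : ZMod 7, a * a ≠ 3 := by decide
  apply key (z.re : ZMod 7)
  have := congrArg (fun t : ℤ ↦ (t : ZMod 7)) h
  push_cast at this
  have h14 : (z.im : ZMod 7) * (z.im : ZMod 7) * 14 = 0 := by
    rw [show (14 : ZMod 7) = 0 by decide, mul_zero]
  linear_combination this + h14

/-- No element of `ℤ[√14]` has norm `−3`: `a² − 14b² ≡ a² − 6b² ≢ 5 (mod 8)`. [cite: Samuel1971, §5 Remark (2) (p. 294)] -/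
theorem norm_ne_neg_three (z : ℤ√14) : z.norm ≠ -3 := by
  rw [norm_def]
  intro h
  have key : ∀ a b : ZMod 8, a * a - 14 * b * b ≠ -3 := by decide
  apply key (z.re : ZMod 8) (z.im : ZMod 8)
  have := congrArg (fun t : ℤ ↦ (t : ZMod 8)) h
  push_cast at this
  exact this

/-- `3` is not a norm, up to sign: `|N(z)| ≠ 3`. [cite: Samuel1971, §5 Remark (2) (p. 294)] -/
theorem natAbs_norm_ne_three (z : ℤ√14) : z.norm.natAbs ≠ 3 := by
  intro h
  rcases Int.natAbs_eq z.norm with h' | h' <;> rw [h] at h'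
  · exact norm_ne_three z (by exact_mod_cast h')
  · exact norm_ne_neg_three z (by exact_mod_cast h')

/-- `3 ∣ z` in `ℤ[√14]` iff `3` divides both coordinates. [cite: Samuel1971, §5 Remark (2) (p. 294)] -/
theorem three_dvd_iff (z : ℤ√14) : (3 : ℤ√14) ∣ z ↔ (3 : ℤ) ∣ z.re ∧ (3 : ℤ) ∣ z.im := by
  constructor
  · rintro ⟨q, rfl⟩
    refine ⟨⟨q.re, ?_⟩, ⟨q.im, ?_⟩⟩
    · simp [re_mul, re_ofNat, im_ofNat]
    · simp [im_mul, re_ofNat, im_ofNat]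
  · rintro ⟨⟨a, ha⟩, ⟨b, hb⟩⟩
    exact ⟨⟨a, b⟩, Zsqrtd.ext (by simp [re_mul, re_ofNat, im_ofNat, ha]) (by simp [im_mul, re_ofNat, im_ofNat, hb])⟩

/-- `3 ∣ z ⟺ 3 ∣ N(z)`: `a² − 14b² ≡ a² + b² ≡ 0 (mod 3)` forces `a ≡ b ≡ 0` (`−1 ≡ 2` is not a square mod `3`) — i.e.
`3` is inert, «the ideal `3A` is prime». [cite: Samuel1971, §5 Remark (2) (p. 294)] -/
theorem three_dvd_iff_three_dvd_norm (z : ℤ√14) : (3 : ℤ√14) ∣ z ↔ (3 : ℤ) ∣ z.norm := by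
  rw [three_dvd_iff, norm_def]
  constructor
  · rintro ⟨⟨a, ha⟩, ⟨b, hb⟩⟩
    rw [ha, hb]
    exact ⟨3 * a * a - 14 * 3 * b * b, by ring⟩
  · intro h
    have key : ∀ a b : ZMod 3, a * a - 14 * b * b = 0 → a = 0 ∧ b = 0 := by decide
    have h3 : ((z.re * z.re - 14 * z.im * z.im : ℤ) : ZMod 3) = 0 := (ZMod.intCast_zmod_eq_zero_iff_dvd _ 3).2 h
    push_cast at h3
    obtain ⟨ha, hb⟩ := key _ _ h3
    exact ⟨(ZMod.intCast_zmod_eq_zero_iff_dvd _ 3).1 ha, (ZMod.intCast_zmod_eq_zero_iff_dvd _ 3).1 hb⟩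

/-- **«the ideal `3A` is prime»**: `3` is a prime element of `ℤ[√14]`. [cite: Samuel1971, §5 Remark (2) (p. 294)] -/
theorem prime_three : Prime (3 : ℤ√14) := by
  refine ⟨by decide, fun hu ↦ ?_, fun z w hzw ↦ ?_⟩
  · have h := norm_eq_one_of_isUnit hu
    rw [norm_def] at h
    simp [re_ofNat, im_ofNat] at h
  · rw [three_dvd_iff_three_dvd_norm, norm_mul] at hzw
    rw [three_dvd_iff_three_dvd_norm, three_dvd_iff_three_dvd_norm]
    have key : ∀ a b : ZMod 3, a * b = 0 → a = 0 ∨ b = 0 := by decide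
    have h0 : ((z.norm * w.norm : ℤ) : ZMod 3) = 0 := (ZMod.intCast_zmod_eq_zero_iff_dvd _ 3).2 hzw
    push_cast at h0
    rcases key _ _ h0 with h | h
    · exact Or.inl ((ZMod.intCast_zmod_eq_zero_iff_dvd _ 3).1 h)
    · exact Or.inr ((ZMod.intCast_zmod_eq_zero_iff_dvd _ 3).1 h)

/-- Samuel's inference «`3` is not a norm in `A` (the ideal `3A` is prime)»: if `N(z) = ±3` then `3 ∣ N(z)`, so `3 ∣ z`,
so `9 ∣ N(z) = ±3` — absurd.  (A second proof of `natAbs_norm_ne_three`, along the printed route.)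
[cite: Samuel1971, §5 Remark (2) (p. 294)] -/
theorem natAbs_norm_ne_three' (z : ℤ√14) : z.norm.natAbs ≠ 3 := by
  intro h
  have h3 : (3 : ℤ) ∣ z.norm := by
    rw [← Int.dvd_natAbs, h]
    norm_num
  obtain ⟨q, hq⟩ := (three_dvd_iff_three_dvd_norm z).2 h3
  have h9 : z.norm = 9 * q.norm := by
    rw [hq, norm_mul]
    congr 1
  omega

/-! ## §3 The coset `1 + √14 + 2A`: both coordinates odd forces `|N| ≥ 5` -/

/-- For `a, b` odd, `a² − 14b² ≡ 3 (mod 8)`. [cite: Samuel1971, §5 Remark (2) (p. 294)] -/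
theorem norm_emod_eight_of_odd {z : ℤ√14} (hre : Odd z.re) (him : Odd z.im) : z.norm % 8 = 3 := by
  obtain ⟨m, hm⟩ := hre
  obtain ⟨k, hk⟩ := him
  rw [norm_def, hm, hk]
  have e1 : (2 * m + 1) * (2 * m + 1) = 4 * (m * (m + 1)) + 1 := by ring
  have e2 : (14 : ℤ) * (2 * k + 1) * (2 * k + 1) = 56 * (k * (k + 1)) + 14 := by ring
  rw [e1, e2]
  have h2 : (2 : ℤ) ∣ m * (m + 1) := Int.even_mul_succ_self m |>.two_dvd
  obtain ⟨c, hc⟩ := h2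
  rw [hc]
  omega

/-- **«none of them can have a norm `< N(2) = 4`»**, sharpened: an element of `ℤ[√14]` with both coordinates odd — i.e.
an element of the coset `1 + √14 + 2A` — has `|N| ≥ 5` (`N ≡ 3 (mod 8)` excludes `0, ±1, ±2, ±4` and `−3`; `+3` is
not a norm). [cite: Samuel1971, §5 Remark (2) (p. 294)] -/
theorem five_le_natAbs_norm_of_odd {z : ℤ√14} (hre : Odd z.re) (him : Odd z.im) : 5 ≤ z.norm.natAbs := by
  have h8 := norm_emod_eight_of_odd hre him
  have h3 := norm_ne_three z
  omega

/-- In particular no element of the coset has `|N| < |N(2)| = 4`. [cite: Samuel1971, §5 Remark (2) (p. 294)] -/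
theorem natAbs_norm_two_le_of_odd {z : ℤ√14} (hre : Odd z.re) (him : Odd z.im) :
    (2 : ℤ√14).norm.natAbs ≤ z.norm.natAbs := by
  have h2 : (2 : ℤ√14).norm.natAbs = 4 := by rw [norm_def]; decide
  rw [h2]
  exact (by norm_num : (4 : ℕ) ≤ 5).trans (five_le_natAbs_norm_of_odd hre him)

/-- Every remainder of `1 + √14` upon division by `2` lies in the coset `1 + √14 + 2A`: both its coordinates are odd.
[cite: Samuel1971, §5 Remark (2) (p. 294)] -/
theorem odd_of_eq_two_mul_add {q r : ℤ√14} (h : (⟨1, 1⟩ : ℤ√14) = 2 * q + r) : Odd r.re ∧ Odd r.im := by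
  have hre := congrArg Zsqrtd.re h
  have him := congrArg Zsqrtd.im h
  simp only [re_add, im_add, re_mul, im_mul, re_ofNat, im_ofNat] at hre him
  exact ⟨⟨-q.re, by omega⟩, ⟨-q.im, by omega⟩⟩

/-! ## §4 `ℤ[√14]` is not Euclidean for the norm -/

/-- **«This shows that `A` is not Euclidean for the norm»**: the absolute norm `|N|` is not an algorithm on `ℤ[√14]`
— `1 + √14` cannot be written `2q + r` with `|N(r)| < |N(2)| = 4`. [cite: Samuel1971, §5 Remark (2) (p. 294) and
Definition 1 (p. 282)] -/
theorem not_normEuclidean :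
    ¬∀ a b : ℤ√14, b ≠ 0 → ∃ q r : ℤ√14, a = b * q + r ∧ r.norm.natAbs < b.norm.natAbs := by
  intro h
  obtain ⟨q, r, hqr, hr⟩ := h ⟨1, 1⟩ 2 (by decide)
  obtain ⟨hre, him⟩ := odd_of_eq_two_mul_add hqr
  exact absurd hr (not_lt.2 (natAbs_norm_two_le_of_odd hre him))

/-- The same with Motzkin's/Mathlib's clause «`r = 0` or `|N(r)| < |N(b)|`» (a zero remainder is impossible too: `2` does
not divide `1 + √14`). [cite: Samuel1971, §5 Remark (2) (p. 294)] -/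
theorem not_normEuclidean' :
    ¬∀ a b : ℤ√14, b ≠ 0 → ∃ q r : ℤ√14, a = b * q + r ∧ (r = 0 ∨ r.norm.natAbs < b.norm.natAbs) := by
  intro h
  obtain ⟨q, r, hqr, hr⟩ := h ⟨1, 1⟩ 2 (by decide)
  obtain ⟨hre, him⟩ := odd_of_eq_two_mul_add hqr
  rcases hr with rfl | hr
  · exact absurd hre (by decide)
  · exact absurd hr (not_lt.2 (natAbs_norm_two_le_of_odd hre him))

/-- No «division with smaller norm» of `1 + √14` by `2`, as a statement about the class of `1 + √14` mod `2`: every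
`z ≡ 1 + √14 (mod 2)` has `|N(z)| ≥ 5 > 4 = |N(2)|`. [cite: Samuel1971, §5 Remark (2) (p. 294)] -/
theorem five_le_natAbs_norm_of_two_dvd_sub {z : ℤ√14} (h : (2 : ℤ√14) ∣ z - ⟨1, 1⟩) : 5 ≤ z.norm.natAbs := by
  obtain ⟨c, hc⟩ := h
  have h' : (⟨1, 1⟩ : ℤ√14) = 2 * (-c) + z := by rw [mul_neg, ← hc]; ring
  obtain ⟨hre, him⟩ := odd_of_eq_two_mul_add h'
  exact five_le_natAbs_norm_of_odd hre him

/-- **Hardy–Wright's criterion (14.7.2) fails for `m = 14`**: at `δ = (1 + √14)/2` every integer `κ = x + y√14` has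
`|N(δ − κ)| = |(½ − x)² − 14(½ − y)²| ≥ 5/4 ≥ 1`. [cite: Samuel1971, §5 Remark (2) (p. 294)] -/
theorem not_criterion : ¬∀ r s : ℚ, ∃ x y : ℤ, |(r - x) ^ 2 - 14 * (s - y) ^ 2| < 1 := by
  intro h
  obtain ⟨x, y, hxy⟩ := h (1 / 2) (1 / 2)
  -- `4 · ((½ − x)² − 14(½ − y)²) = N((1 − 2x) + (1 − 2y)√14)`, an integer `≡ 3 (mod 8)` with `|·| ≥ 5`
  have hodd : Odd (⟨1 - 2 * x, 1 - 2 * y⟩ : ℤ√14).re ∧ Odd (⟨1 - 2 * x, 1 - 2 * y⟩ : ℤ√14).im :=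
    ⟨⟨-x, by simp; ring⟩, ⟨-y, by simp; ring⟩⟩
  have h5 := five_le_natAbs_norm_of_odd hodd.1 hodd.2
  rw [norm_def] at h5
  simp only at h5
  have key : ((1 / 2 - x) ^ 2 - 14 * (1 / 2 - y) ^ 2 : ℚ) =
      (((1 - 2 * x) * (1 - 2 * x) - 14 * (1 - 2 * y) * (1 - 2 * y) : ℤ) : ℚ) / 4 := by
    push_cast; ring
  rw [key] at hxy
  obtain ⟨hlo, hhi⟩ := abs_lt.1 hxy
  have hlo' : -4 < (1 - 2 * x) * (1 - 2 * x) - 14 * (1 - 2 * y) * (1 - 2 * y) := by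
    have : (-4 : ℚ) < (((1 - 2 * x) * (1 - 2 * x) - 14 * (1 - 2 * y) * (1 - 2 * y) : ℤ) : ℚ) := by linarith
    exact_mod_cast this
  have hhi' : (1 - 2 * x) * (1 - 2 * x) - 14 * (1 - 2 * y) * (1 - 2 * y) < 4 := by
    have : (((1 - 2 * x) * (1 - 2 * x) - 14 * (1 - 2 * y) * (1 - 2 * y) : ℤ) : ℚ) < 4 := by linarith
    exact_mod_cast this
  omega

end Literature.NumberTheory.QuadraticFields.ZSqrtFourteen
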